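import Mathlib
import Literature.Computability.AlgebraicComplexity.DeterminantalConormalBound
import Literature.Computability.AlgebraicComplexity.HessianRank
import Literature.NumberTheory.Transcendental.AnalytificationFunctorialityProofs

/-!
# Crux `DetQP.DetqpSuperquadratic` (stmt-ValiantsHypothesis-0318), line `sectional-class-ladder`
(skeleton v2, ND route) — stub `stub_polarPersistenceND`: persistence of non-degenerate polar
points, KEEPING non-degeneracy

For a polynomial `g` in `N` variables and a pencil/chart datum `u = (a, b, c) ∈ (ℂ^N)³` (encoded
`u : Fin 3 × Fin N → ℂ`, rows `0, 1, 2 = a, b, c`) the polar set `T_g(a, b, c)`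
(`Literature.Computability.AlgebraicComplexity.polarSet`) consists of the points `x` with
`g(x) = 0`, `∇g(x) ≠ 0`, `∇g(x) ∈ ℂa + ℂb`, `c · x = 1`; a polar point is *non-degenerate* when
the bordered-Hessian Jacobian `J(u, x) = [[∂ᵢ∂ⱼg(x), (aᵢ bᵢ)], [(∂ⱼg(x); cⱼ), 0]]` is invertible.
This file proves the registered stub

* `stub_polarPersistenceND` : if at one datum `(a, b, c)` the polar set contains a finite set `F`
  of non-degenerate points, then off every hypersurface `Φ = 0` of the data space there is a datum
  `u` whose polar set contains at least `|F|` NON-DEGENERATE points (non-degeneracy w.r.t. the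
  same Jacobian at the new datum `u`).

**Proof** (the argument of the sibling stub `stub_polarPersistence`,
`Theorems/DetQPDetqpSuperquadraticStubPolarPersistence.lean`, run with the strengthened invariant).
A polar point `x₀` with multipliers `(s, t)` (`∇g(x₀) = s a + t b`) gives a zero `(x₀, -s, -t)` of
the SQUARE polynomial system in the unknowns `z = (x, s', t') ∈ ℂ^N × ℂ²` (indexed by
`Fin N ⊕ Fin 2`) with parameters `u`, `G(u; z) = ((∂ᵢg(x) + s' u₀ᵢ + t' u₁ᵢ)ᵢ, g(x), Σⱼ u₂ⱼxⱼ)`,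
values `(0, 0, 1)`; its Jacobian `∂G/∂z` at such a zero is literally the displayed block matrix
(`∂ᵢ∂ⱼ = ∂ⱼ∂ᵢ`, `Literature.Computability.AlgebraicComplexity.pderiv_pderiv_comm`).  Polynomial
maps are strictly differentiable with the gradient as derivative
(`Literature.NumberTheory.Transcendental.MvPolynomial.hasStrictFDerivAt_eval`), so Mathlib's
implicit function theorem on a product domain (`HasStrictFDerivAt.implicitFunctionOfProdDomain`;
the partial derivative is invertible by `ContinuousLinearMap.toContinuousLinearEquivOfDetNeZero`)
continues `x₀` to a branch `u ↦ x(u)` of zeros with `x(u) → x₀`, i.e. of polar points of the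
datum `u` for `u` near `u₀` (`∇g ≠ 0` is open); and since `det J(u, x)` is a continuous function
of `(u, x)` (`PolarPersistenceND.continuous_jacobianDet`) with `det J(u₀, x₀) ≠ 0`, the branch
consists of NON-DEGENERATE polar points near `u₀` — `PolarPersistenceND.exists_branchND`.
Finitely many branches with distinct limits stay pairwise distinct near `u₀`, and `{Φ ≠ 0}` meets
every neighbourhood of `u₀` because a polynomial vanishing on a ball of `(ℂ^N)³` (a box with
infinite sides) is zero (`MvPolynomial.funext_set`); at such a datum `u` the set
`F' = {x(u) : x ∈ F}` has `|F'| = |F|` non-degenerate polar points.  No new definitions;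
self-contained on Mathlib and the Literature entries `DeterminantalConormalBound` (`polarSet`),
`HessianRank` (`pderiv_pderiv_comm`) and `Transcendental.AnalytificationFunctorialityProofs`
(`MvPolynomial.hasStrictFDerivAt_eval`).
-/

noncomputable section

-- `Summit.ValiantsHypothesis.ValiantsHypothesis.…` is the tree's mandated single-conjunct layout
-- (Sub = Summit), so the duplicated namespace component is intended.
set_option linter.dupNamespace false

namespace Summit.ValiantsHypothesis.ValiantsHypothesis.Theorems.DetQPDetqpSuperquadratic

open MvPolynomial Filter Topology
open Literature.Computability.AlgebraicComplexity

namespace PolarPersistenceND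

/-- **The bordered-Hessian Jacobian determinant is continuous in `(u, x)`**: the determinant of
`J(u, x) = [[∂ᵢ∂ⱼg(x), (u₀ᵢ u₁ᵢ)], [(∂ⱼg(x); u₂ⱼ), 0]]` depends continuously on the pair
(datum `u`, point `x`), its entries being polynomial evaluations and coordinates. [folklore] -/
theorem continuous_jacobianDet {N : ℕ} (g : MvPolynomial (Fin N) ℂ) :
    Continuous fun w : (Fin 3 × Fin N → ℂ) × (Fin N → ℂ) => (Matrix.fromBlocks
      (Matrix.of fun i j : Fin N => eval w.2 (pderiv i (pderiv j g)))
      (Matrix.of fun (i : Fin N) (l : Fin 2) => ![w.1 (0, i), w.1 (1, i)] l)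
      (Matrix.of fun (l : Fin 2) (j : Fin N) => ![eval w.2 (pderiv j g), w.1 (2, j)] l)
      (0 : Matrix (Fin 2) (Fin 2) ℂ)).det := by
  refine Continuous.matrix_det (Continuous.matrix_fromBlocks ?_ ?_ ?_ continuous_const)
  · exact continuous_matrix fun i j => (continuous_eval _).comp continuous_snd
  · refine continuous_matrix fun i => ?_
    rw [Fin.forall_fin_two]
    exact ⟨((continuous_apply (0, i)).comp continuous_fst :
        Continuous fun w : (Fin 3 × Fin N → ℂ) × (Fin N → ℂ) => w.1 (0, i)),
      ((continuous_apply (1, i)).comp continuous_fst :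
        Continuous fun w : (Fin 3 × Fin N → ℂ) × (Fin N → ℂ) => w.1 (1, i))⟩
  · refine continuous_matrix ?_
    rw [Fin.forall_fin_two]
    exact ⟨fun j => (continuous_eval _).comp continuous_snd,
      fun j => ((continuous_apply (2, j)).comp continuous_fst :
        Continuous fun w : (Fin 3 × Fin N → ℂ) × (Fin N → ℂ) => w.1 (2, j))⟩

/-- **Persistence of one non-degenerate polar point, with its non-degeneracy** (implicit function
theorem).  Let `x₀ ∈ T_g(a, b, c)` be a polar point at the datum `u₀ = (a, b, c)` at which the
bordered-Hessian Jacobian `J(u₀, x₀) = [[∂ᵢ∂ⱼg(x₀), (aᵢ bᵢ)], [(∂ⱼg(x₀); cⱼ), 0]]` is invertible.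
Then there is a branch `φ : (ℂ^N)³ → ℂ^N`, `φ(u) → x₀` as `u → u₀`, such that for all `u` near
`u₀` the point `φ(u)` lies in `T_g(u)` AND `J(u, φ(u))` is invertible.  Proof: `(x₀, -s, -t)` is a
zero of the square polynomial system `G(u; x, s', t') = ((∂ᵢg(x) + s'aᵢ + t'bᵢ)ᵢ, g(x), Σ cⱼxⱼ)`
(values `(0, 0, 1)`), strictly differentiable in `(u, x, s', t')` with `∂G/∂(x, s', t')` the
displayed matrix; apply `HasStrictFDerivAt.implicitFunctionOfProdDomain`, and keep `∇g ≠ 0` and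
`det J ≠ 0` by continuity (`continuous_jacobianDet`). [folklore] -/
theorem exists_branchND {N : ℕ} (g : MvPolynomial (Fin N) ℂ) (u₀ : Fin 3 × Fin N → ℂ)
    (x₀ : Fin N → ℂ)
    (hx₀ : x₀ ∈ polarSet g (fun i => u₀ (0, i)) (fun i => u₀ (1, i)) (fun i => u₀ (2, i)))
    (hdet : (Matrix.fromBlocks
        (Matrix.of fun i j : Fin N => eval x₀ (pderiv i (pderiv j g)))
        (Matrix.of fun (i : Fin N) (l : Fin 2) => ![u₀ (0, i), u₀ (1, i)] l)
        (Matrix.of fun (l : Fin 2) (j : Fin N) => ![eval x₀ (pderiv j g), u₀ (2, j)] l)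
        (0 : Matrix (Fin 2) (Fin 2) ℂ)).det ≠ 0) :
    ∃ φ : (Fin 3 × Fin N → ℂ) → (Fin N → ℂ), Tendsto φ (𝓝 u₀) (𝓝 x₀) ∧
      ∀ᶠ u in 𝓝 u₀,
        φ u ∈ polarSet g (fun i => u (0, i)) (fun i => u (1, i)) (fun i => u (2, i)) ∧
          (Matrix.fromBlocks
            (Matrix.of fun i j : Fin N => eval (φ u) (pderiv i (pderiv j g)))
            (Matrix.of fun (i : Fin N) (l : Fin 2) => ![u (0, i), u (1, i)] l)
            (Matrix.of fun (l : Fin 2) (j : Fin N) => ![eval (φ u) (pderiv j g), u (2, j)] l)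
            (0 : Matrix (Fin 2) (Fin 2) ℂ)).det ≠ 0 := by
  -- adapted from Theorems/DetQPDetqpSuperquadraticStubPolarPersistence.lean (p98143),
  -- `PolarPersistence.exists_branch`: same implicit-function branch, plus persistence of `det ≠ 0`
  classical
  obtain ⟨hg0, ⟨i₀, hi₀⟩, ⟨s₀, t₀, hst⟩, hchart⟩ := hx₀
  simp only at hst hchart
  -- base point of the unknowns `z = (x, s', t')` (`s' = -s`, `t' = -t`)
  set z₀ : Fin N ⊕ Fin 2 → ℂ := Sum.elim x₀ ![-s₀, -t₀]
  have hz₀l : ∀ j, z₀ (Sum.inl j) = x₀ j := fun j => rfl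
  have hz₀0 : z₀ (Sum.inr 0) = -s₀ := rfl
  have hz₀1 : z₀ (Sum.inr 1) = -t₀ := rfl
  -- restriction `z ↦ x`
  set R : (Fin N ⊕ Fin 2 → ℂ) →L[ℂ] (Fin N → ℂ) :=
    ContinuousLinearMap.pi fun j => ContinuousLinearMap.proj (Sum.inl j)
  have hRv : ∀ (w : Fin N ⊕ Fin 2 → ℂ) (j : Fin N), R w j = w (Sum.inl j) := fun w j => rfl
  have hRz₀ : R z₀ = x₀ := funext fun j => rfl
  -- the Jacobian of the hypothesis
  set M : Matrix (Fin N ⊕ Fin 2) (Fin N ⊕ Fin 2) ℂ := Matrix.fromBlocks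
      (Matrix.of fun i j : Fin N => eval x₀ (pderiv i (pderiv j g)))
      (Matrix.of fun (i : Fin N) (l : Fin 2) => ![u₀ (0, i), u₀ (1, i)] l)
      (Matrix.of fun (l : Fin 2) (j : Fin N) => ![eval x₀ (pderiv j g), u₀ (2, j)] l)
      (0 : Matrix (Fin 2) (Fin 2) ℂ)
  -- the square system, componentwise, on `parameters × unknowns`
  set Gc : Fin N ⊕ Fin 2 → (Fin 3 × Fin N → ℂ) × (Fin N ⊕ Fin 2 → ℂ) → ℂ :=
    Sum.elim (fun i w => eval (R w.2) (pderiv i g) + w.2 (Sum.inr 0) * w.1 (0, i) +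
        w.2 (Sum.inr 1) * w.1 (1, i))
      ![fun w => eval (R w.2) g, fun w => ∑ j, w.1 (2, j) * w.2 (Sum.inl j)]
  have eGl : ∀ i, Gc (Sum.inl i) = fun w => eval (R w.2) (pderiv i g) +
      w.2 (Sum.inr 0) * w.1 (0, i) + w.2 (Sum.inr 1) * w.1 (1, i) := fun i => rfl
  have eG0 : Gc (Sum.inr 0) = fun w => eval (R w.2) g := rfl
  have eG1 : Gc (Sum.inr 1) = fun w => ∑ j, w.1 (2, j) * w.2 (Sum.inl j) := rfl
  -- strict derivatives of the building blocks at `(u₀, z₀)`: coordinates and `w ↦ q(x)`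
  set pu : Fin 3 × Fin N → ((Fin 3 × Fin N → ℂ) × (Fin N ⊕ Fin 2 → ℂ) →L[ℂ] ℂ) :=
    fun k => (ContinuousLinearMap.proj k).comp (ContinuousLinearMap.fst ℂ _ _)
  set pz : Fin N ⊕ Fin 2 → ((Fin 3 × Fin N → ℂ) × (Fin N ⊕ Fin 2 → ℂ) →L[ℂ] ℂ) :=
    fun k => (ContinuousLinearMap.proj k).comp (ContinuousLinearMap.snd ℂ _ _)
  have hpu : ∀ k, HasStrictFDerivAt
      (fun w : (Fin 3 × Fin N → ℂ) × (Fin N ⊕ Fin 2 → ℂ) => w.1 k) (pu k) (u₀, z₀) :=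
    fun k => (pu k).hasStrictFDerivAt
  have hpz : ∀ k, HasStrictFDerivAt
      (fun w : (Fin 3 × Fin N → ℂ) × (Fin N ⊕ Fin 2 → ℂ) => w.2 k) (pz k) (u₀, z₀) :=
    fun k => (pz k).hasStrictFDerivAt
  have hpuv : ∀ k w, pu k w = w.1 k := fun k w => rfl
  have hpzv : ∀ k w, pz k w = w.2 k := fun k w => rfl
  have hev : ∀ q : MvPolynomial (Fin N) ℂ, HasStrictFDerivAt
      (fun w : (Fin 3 × Fin N → ℂ) × (Fin N ⊕ Fin 2 → ℂ) => eval (R w.2) q)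
      ((∑ j, eval x₀ (pderiv j q) • (ContinuousLinearMap.proj j : (Fin N → ℂ) →L[ℂ] ℂ)).comp
        (R.comp (ContinuousLinearMap.snd ℂ _ _))) (u₀, z₀) := by
    intro q
    have h := Literature.NumberTheory.Transcendental.MvPolynomial.hasStrictFDerivAt_eval q
      (R (u₀, z₀).2)
    rw [show R (u₀, z₀).2 = x₀ from hRz₀] at h
    exact h.comp (u₀, z₀) (R.comp (ContinuousLinearMap.snd ℂ _ _)).hasStrictFDerivAt
  -- each component is strictly differentiable, with `z`-partial the corresponding row of `M`
  have hcomp : ∀ k, ∃ E : (Fin 3 × Fin N → ℂ) × (Fin N ⊕ Fin 2 → ℂ) →L[ℂ] ℂ,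
      HasStrictFDerivAt (Gc k) E (u₀, z₀) ∧ ∀ v, E (0, v) = (M.mulVec v) k := by
    rintro (i | l)
    · rw [eGl i]
      refine ⟨_, ((hev (pderiv i g)).fun_add ((hpz _).fun_mul (hpu _))).fun_add
        ((hpz _).fun_mul (hpu _)), fun v => ?_⟩
      simp [hRv, hpuv, hpzv, hz₀0, hz₀1, M, Matrix.mulVec, dotProduct, Fintype.sum_sum_type,
        Fin.sum_univ_two, pderiv_pderiv_comm _ i g]
      ring
    · revert l
      rw [Fin.forall_fin_two]
      refine ⟨?_, ?_⟩
      · rw [eG0]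
        refine ⟨_, hev g, fun v => ?_⟩
        simp [hRv, M, Matrix.mulVec, dotProduct, Fintype.sum_sum_type]
      · rw [eG1]
        refine ⟨_, HasStrictFDerivAt.fun_sum fun j _ => (hpu (2, j)).fun_mul (hpz (Sum.inl j)),
          fun v => ?_⟩
        simp [hpuv, hpzv, hz₀l, M, Matrix.mulVec, dotProduct, Fintype.sum_sum_type]
  choose E hE hEv using hcomp
  have hG : HasStrictFDerivAt (fun w k => Gc k w) (ContinuousLinearMap.pi E) (u₀, z₀) :=
    hasStrictFDerivAt_pi.2 hE
  -- the partial derivative in the unknowns is `M`, hence invertible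
  set T := (ContinuousLinearMap.pi E).comp
    (ContinuousLinearMap.inr ℂ (Fin 3 × Fin N → ℂ) (Fin N ⊕ Fin 2 → ℂ))
  have hTM : (T : (Fin N ⊕ Fin 2 → ℂ) →ₗ[ℂ] (Fin N ⊕ Fin 2 → ℂ)) = Matrix.toLin' M := by
    refine LinearMap.ext fun v => funext fun k => ?_
    rw [Matrix.toLin'_apply]
    exact hEv k v
  have hdetT : T.det ≠ 0 := by
    change LinearMap.det (T : (Fin N ⊕ Fin 2 → ℂ) →ₗ[ℂ] (Fin N ⊕ Fin 2 → ℂ)) ≠ 0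
    rw [hTM, LinearMap.det_toLin']
    exact hdet
  have hinv : T.IsInvertible :=
    ⟨T.toContinuousLinearEquivOfDetNeZero hdetT,
      ContinuousLinearMap.coe_toContinuousLinearEquivOfDetNeZero T hdetT⟩
  -- the implicit function `ψ : u ↦ z(u)` and the branch `φ = R ∘ ψ`
  set ψ := hG.implicitFunctionOfProdDomain hinv
  have hψt : Tendsto ψ (𝓝 u₀) (𝓝 z₀) := hG.tendsto_implicitFunctionOfProdDomain hinv
  have hψe : ∀ᶠ u in 𝓝 u₀, (fun k => Gc k (u, ψ u)) = fun k => Gc k (u₀, z₀) :=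
    hG.eventually_apply_implicitFunctionOfProdDomain hinv
  have hRψ : Tendsto (fun u => R (ψ u)) (𝓝 u₀) (𝓝 x₀) := by
    rw [← hRz₀]
    exact (R.continuous.tendsto z₀).comp hψt
  refine ⟨fun u => R (ψ u), hRψ, ?_⟩
  have hgrad : ∀ᶠ u in 𝓝 u₀, eval (R (ψ u)) (pderiv i₀ g) ≠ 0 :=
    (((continuous_eval (pderiv i₀ g)).tendsto x₀).comp hRψ).eventually_ne hi₀
  -- non-degeneracy persists: `det J(u, x)` is continuous in `(u, x)` and `≠ 0` at `(u₀, x₀)`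
  have hndeg : ∀ᶠ u in 𝓝 u₀, (Matrix.fromBlocks
      (Matrix.of fun i j : Fin N => eval (R (ψ u)) (pderiv i (pderiv j g)))
      (Matrix.of fun (i : Fin N) (l : Fin 2) => ![u (0, i), u (1, i)] l)
      (Matrix.of fun (l : Fin 2) (j : Fin N) => ![eval (R (ψ u)) (pderiv j g), u (2, j)] l)
      (0 : Matrix (Fin 2) (Fin 2) ℂ)).det ≠ 0 :=
    (((continuous_jacobianDet g).tendsto (u₀, x₀)).comp (tendsto_id.prodMk_nhds hRψ)).eventually_ne
      hdet
  filter_upwards [hψe, hgrad, hndeg] with u hu hgu hdu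
  refine ⟨?_, hdu⟩
  have h1 : ∀ i, Gc (Sum.inl i) (u, ψ u) = Gc (Sum.inl i) (u₀, z₀) :=
    fun i => congr_fun hu (Sum.inl i)
  have h2 : Gc (Sum.inr 0) (u, ψ u) = Gc (Sum.inr 0) (u₀, z₀) := congr_fun hu (Sum.inr 0)
  have h3 : Gc (Sum.inr 1) (u, ψ u) = Gc (Sum.inr 1) (u₀, z₀) := congr_fun hu (Sum.inr 1)
  rw [eG0] at h2
  rw [eG1] at h3
  simp only [hRz₀, hz₀l] at h2 h3
  refine mem_polarSet.2 ⟨h2.trans hg0, ⟨i₀, hgu⟩,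
    ⟨-ψ u (Sum.inr 0), -ψ u (Sum.inr 1), fun i => ?_⟩, ?_⟩
  · have h1i := h1 i
    simp only [eGl, hRz₀, hz₀0, hz₀1, hst i] at h1i
    linear_combination h1i
  · simp only [hRv]
    exact h3.trans hchart

end PolarPersistenceND

open PolarPersistenceND in
/-- **Registered sub-goal `stub_polarPersistenceND` — persistence of non-degenerate polar points,
keeping non-degeneracy.**  If at one datum `(a, b, c)` the polar set of `g` contains a finite set
`F` of non-degenerate zeros of the square polar system (bordered-Hessian Jacobian invertible), then
off every hypersurface `Φ = 0` of the data space `(ℂ^N)³` there is a datum `u` whose polar set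
contains at least `|F|` points that are again non-degenerate (same Jacobian, at `u`).  Proof: each
`x ∈ F` continues to a branch `φₓ(u)` of non-degenerate polar points of `T_g(u)` with `φₓ(u) → x`
(`PolarPersistenceND.exists_branchND`); near `u₀ = (a, b, c)` the finitely many branches stay
pairwise distinct, and `{Φ ≠ 0}` meets every neighbourhood of `u₀` (a polynomial vanishing on a
ball vanishes on a box with infinite sides, hence is `0`, `MvPolynomial.funext_set`). [folklore] -/
theorem stub_polarPersistenceND {N : ℕ} (g : MvPolynomial (Fin N) ℂ) (a b c : Fin N → ℂ)
    (F : Finset (Fin N → ℂ))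
    (hF : ∀ x ∈ F, x ∈ polarSet g a b c ∧
      (Matrix.fromBlocks
        (Matrix.of fun i j : Fin N => eval x (pderiv i (pderiv j g)))
        (Matrix.of fun (i : Fin N) (l : Fin 2) => ![a i, b i] l)
        (Matrix.of fun (l : Fin 2) (j : Fin N) => ![eval x (pderiv j g), c j] l)
        (0 : Matrix (Fin 2) (Fin 2) ℂ)).det ≠ 0)
    (Φ : MvPolynomial (Fin 3 × Fin N) ℂ) (hΦ : Φ ≠ 0) :
    ∃ u : Fin 3 × Fin N → ℂ, eval u Φ ≠ 0 ∧
      ∃ F' : Finset (Fin N → ℂ), F.card ≤ F'.card ∧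
        ∀ x ∈ F', x ∈ polarSet g (fun i => u (0, i)) (fun i => u (1, i)) (fun i => u (2, i)) ∧
          (Matrix.fromBlocks
            (Matrix.of fun i j : Fin N => eval x (pderiv i (pderiv j g)))
            (Matrix.of fun (i : Fin N) (l : Fin 2) => ![u (0, i), u (1, i)] l)
            (Matrix.of fun (l : Fin 2) (j : Fin N) => ![eval x (pderiv j g), u (2, j)] l)
            (0 : Matrix (Fin 2) (Fin 2) ℂ)).det ≠ 0 := by
  classical
  -- the base datum `u₀ = (a, b, c)`
  set u₀ : Fin 3 × Fin N → ℂ := fun p => ![a p.2, b p.2, c p.2] p.1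
  have ha : ∀ i, u₀ (0, i) = a i := fun i => rfl
  have hb : ∀ i, u₀ (1, i) = b i := fun i => rfl
  have hc : ∀ i, u₀ (2, i) = c i := fun i => rfl
  -- one continuous branch of NON-DEGENERATE polar points through each point of `F`
  have key : ∀ x ∈ F, ∃ φ : (Fin 3 × Fin N → ℂ) → (Fin N → ℂ), Tendsto φ (𝓝 u₀) (𝓝 x) ∧
      ∀ᶠ u in 𝓝 u₀,
        φ u ∈ polarSet g (fun i => u (0, i)) (fun i => u (1, i)) (fun i => u (2, i)) ∧
          (Matrix.fromBlocks
            (Matrix.of fun i j : Fin N => eval (φ u) (pderiv i (pderiv j g)))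
            (Matrix.of fun (i : Fin N) (l : Fin 2) => ![u (0, i), u (1, i)] l)
            (Matrix.of fun (l : Fin 2) (j : Fin N) => ![eval (φ u) (pderiv j g), u (2, j)] l)
            (0 : Matrix (Fin 2) (Fin 2) ℂ)).det ≠ 0 := by
    intro x hx
    obtain ⟨hmem, hdet⟩ := hF x hx
    refine exists_branchND g u₀ x ?_ ?_
    · simp only [ha, hb, hc]
      exact hmem
    · simp only [ha, hb, hc]
      exact hdet
  choose! φ hφt hφm using key
  -- near `u₀` all branches are non-degenerate polar points and pairwise distinct
  have hev₁ := (Filter.eventually_all_finset F).2 hφm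
  have hev₂ : ∀ᶠ u in 𝓝 u₀, ∀ x ∈ F, ∀ x' ∈ F, x ≠ x' → φ x u ≠ φ x' u := by
    refine (Filter.eventually_all_finset F).2 fun x hx =>
      (Filter.eventually_all_finset F).2 fun x' hx' => ?_
    by_cases hxx' : x = x'
    · exact Filter.Eventually.of_forall fun u h => (h hxx').elim
    · exact (((hφt x hx).prodMk_nhds (hφt x' hx')).eventually
        ((isOpen_ne_fun continuous_fst continuous_snd).mem_nhds hxx')).mono fun u h _ => h
  -- `{Φ ≠ 0}` meets every neighbourhood of `u₀`
  -- (adapted from Theorems/DetQPDetqpSuperquadraticStubPolarPersistence.lean (p98143),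
  -- `PolarPersistence.frequently_eval_ne_zero`)
  have hfreq : ∃ᶠ u in 𝓝 u₀, eval u Φ ≠ 0 := by
    by_contra h
    simp only [Filter.not_frequently, not_not] at h
    obtain ⟨ε, hε, hball⟩ := Metric.eventually_nhds_iff_ball.1 h
    refine hΦ (MvPolynomial.funext_set (fun k => Metric.ball (u₀ k) ε)
      (fun k => infinite_of_mem_nhds (u₀ k) (Metric.ball_mem_nhds _ hε)) fun x hx => ?_)
    rw [map_zero]
    refine hball x ?_
    rw [ball_pi _ hε]
    exact hx
  -- a good datum off `Φ = 0`
  obtain ⟨u, ⟨h₁, h₂⟩, hu⟩ := ((hev₁.and hev₂).and_frequently hfreq).exists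
  refine ⟨u, hu, F.image fun x => φ x u, ?_, fun y hy => ?_⟩
  · rw [Finset.card_image_of_injOn fun x hx x' hx' h =>
      by_contra fun hne => h₂ x hx x' hx' hne h]
  · obtain ⟨x, hx, rfl⟩ := Finset.mem_image.1 hy
    exact h₁ x hx

end Summit.ValiantsHypothesis.ValiantsHypothesis.Theorems.DetQPDetqpSuperquadratic
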